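import Mathlib
import HarnessLib
import Literature.NumberTheory.LFunctions.MuentzFormulaStrip
import Summits.RiemannHypothesis.RiemannHypothesis.Theorems.IntegerScrewSmoothSectorDefs
import Summits.RiemannHypothesis.RiemannHypothesis.Theorems.ScrewLemmaKCoprofileCalculus
import Summits.RiemannHypothesis.RiemannHypothesis.Theorems.SmoothSectorHardyDefs

/-!
# Route `SmoothSectorHardy` — Müntz's formula for the LATTICE PROFILE on `Re w > 0`, the
# integration by parts `∫₀¹ g u^{w−1} = −(1/w)∫₀¹ g′ u^w`, and the plateau bookkeeping
# (toolkit for K1a `ProfileMellinFormula`, stmt-RiemannHypothesis-21565)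

For an admissible generator `g` (`C¹` on `[0,1]`, `g(1) = 0`, `∫₀¹ g = 0`, …) with lattice profile
`h(y) = Σ_{n ≤ 1/y} g(ny)` and plateau `h₀ = −g(0)/2`:

* `tsum_indicator_eq_latticeProfile` — `Σ_{n ≥ 1} (1_{(0,1]}g)(n y) = h(y)` (`y > 0`);
* `mellin_latticeProfile_eq` — **Müntz (2.11.1) with `∫F = 0`** for the profile, from the tree's
  `Literature.NumberTheory.LFunctions.mellin_tsum_indicator_comp_mul_nat` (Titchmarsh 1986 §2.11):
  for `Re w > 0`, `w ≠ 1`, `𝓜h(w)` converges absolutely and equals `ζ(w)·∫₀¹ g(u)u^{w−1} du`;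
* `integral_mul_cpow_eq_of_admissible` — one-sided IBP (`g(1) = 0`):
  `∫₀¹ g(u)u^{w−1} du = −(1/w)·∫₀¹ g′(u)u^w du` for `Re w > 0`;
* `mellin_latticeProfile_eq_profileDev_add` — with `Ψ = profileDev g = 1_{(0,1)}·(h − h₀)` (Defs file),
  `𝓜h(w) = 𝓜Ψ(w) + h₀/w` on `Re w > 0`; and `mellin_profileFun_eq_profileDev_add` — for the profile
  function `H = profileFun g = Ψ − h₀·1_{[1,∞)}` of item 21565, `𝓜H(w) = 𝓜Ψ(w) + h₀/w` wherever `𝓜H(w)`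
  converges absolutely with `Re w < 0`.

RH-free; nothing here bears on the truth of RH.
-/

set_option linter.dupNamespace false

noncomputable section

namespace Summit.RiemannHypothesis.RiemannHypothesis.Theorems.SmoothSectorHardy

open MeasureTheory Set Filter Complex Topology
open Summit.RiemannHypothesis.RiemannHypothesis.Theorems.IntegerScrew (latticeProfile
  latticePlateau SmoothSectorAdmissible)
open Summit.RiemannHypothesis.RiemannHypothesis.Theorems.ScrewLemmaKCoprofile
  (hasDerivAt_of_contDiffOn_Icc intervalIntegrable_deriv_of_contDiffOn)

/-! ## The profile as a Müntz sum -/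

/-- `Σ_{n ≥ 1} (1_{(0,1]}·g)(n y) = h(y) = Σ_{n ≤ 1/y} g(ny)` for `y > 0` (the `tsum` is a finite
sum). [folklore] -/
theorem tsum_indicator_eq_latticeProfile (g : ℝ → ℝ) {y : ℝ} (hy : 0 < y) :
    ∑' n : ℕ, (Ioc (0:ℝ) 1).indicator (fun u => ((g u : ℝ) : ℂ)) (((n + 1 : ℕ) : ℝ) * y)
      = ((latticeProfile g y : ℝ) : ℂ) := by
  unfold latticeProfile
  have hsupp : ∀ n ∉ Finset.range ⌊1 / y⌋₊,
      (Ioc (0:ℝ) 1).indicator (fun u => ((g u : ℝ) : ℂ)) (((n + 1 : ℕ) : ℝ) * y) = 0 := by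
    intro n hn
    rw [Finset.mem_range, not_lt] at hn
    apply indicator_of_notMem
    intro hmem
    have h1 : 1 / y < (⌊1 / y⌋₊ : ℝ) + 1 := Nat.lt_floor_add_one (1 / y)
    have h2 : (⌊1 / y⌋₊ : ℝ) + 1 ≤ (n : ℝ) + 1 := by exact_mod_cast Nat.add_le_add_right hn 1
    have h3 : 1 / y < (n : ℝ) + 1 := lt_of_lt_of_le h1 h2
    have h4 : (1:ℝ) < ((n + 1 : ℕ) : ℝ) * y := by
      calc (1:ℝ) = (1 / y) * y := by field_simp
        _ < ((n : ℝ) + 1) * y := mul_lt_mul_of_pos_right h3 hy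
        _ = ((n + 1 : ℕ) : ℝ) * y := by push_cast; ring
    exact absurd hmem.2 (not_le.mpr h4)
  rw [tsum_eq_sum hsupp, ← Finset.Ico_add_one_right_eq_Icc, Finset.sum_Ico_eq_sum_range,
    Nat.add_sub_cancel, Complex.ofReal_sum]
  refine Finset.sum_congr rfl fun n hn => ?_
  rw [Finset.mem_range] at hn
  have hle : ((n + 1 : ℕ) : ℝ) * y ≤ 1 := by
    have h3 : ((n + 1 : ℕ) : ℝ) ≤ 1 / y := (Nat.le_floor_iff (by positivity)).mp hn
    calc ((n + 1 : ℕ) : ℝ) * y ≤ (1 / y) * y := mul_le_mul_of_nonneg_right h3 hy.le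
      _ = 1 := by field_simp
  have hmem : ((n + 1 : ℕ) : ℝ) * y ∈ Ioc (0:ℝ) 1 := ⟨by positivity, hle⟩
  rw [indicator_of_mem hmem]
  have e : ((1 + n : ℕ) : ℝ) = ((n + 1 : ℕ) : ℝ) := by push_cast; ring
  rw [e]

/-- The Mellin transform of the datum `1_{(0,1]}·g` is `∫₀¹ g(u) u^{w−1} du` (same Bochner
integral on both sides). [folklore] -/
theorem mellin_indicator_ofReal (g : ℝ → ℝ) (w : ℂ) :
    mellin ((Ioc (0:ℝ) 1).indicator (fun u => ((g u : ℝ) : ℂ))) w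
      = ∫ u in Ioo (0:ℝ) 1, ((g u : ℝ) : ℂ) * (u : ℂ) ^ (w - 1) := by
  unfold mellin
  rw [setIntegral_eq_of_subset_of_forall_sdiff_eq_zero measurableSet_Ioi Ioc_subset_Ioi_self
    ?_, integral_Ioc_eq_integral_Ioo]
  · refine setIntegral_congr_fun measurableSet_Ioo fun u hu => ?_
    rw [indicator_of_mem (Ioo_subset_Ioc_self hu), smul_eq_mul, mul_comm]
  · intro u hu
    have h1 : u ∉ Ioc (0:ℝ) 1 := fun h => hu.2 h
    simp [indicator_of_notMem h1]

/-- **Müntz's formula for the lattice profile** (`Re w > 0`, `w ≠ 1`; Titchmarsh 1986 §2.11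
(2.11.1) with `∫₀¹ g = 0`, tree `mellin_tsum_indicator_comp_mul_nat`): `𝓜h(w)` converges
absolutely and equals `ζ(w) ∫₀¹ g(u) u^{w−1} du`. [cite: Titchmarsh1986, §2.11 (2.11.1)] -/
theorem mellin_latticeProfile_eq {g : ℝ → ℝ} (hg : SmoothSectorAdmissible g) {w : ℂ}
    (hw : 0 < w.re) (hw1 : w ≠ 1) :
    MellinConvergent (fun y => ((latticeProfile g y : ℝ) : ℂ)) w ∧
      mellin (fun y => ((latticeProfile g y : ℝ) : ℂ)) w
        = riemannZeta w * ∫ u in Ioo (0:ℝ) 1, ((g u : ℝ) : ℂ) * (u : ℂ) ^ (w - 1) := by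
  obtain ⟨hC, _, hI, _⟩ := hg
  obtain ⟨L, hL⟩ := Literature.NumberTheory.LFunctions.exists_lipschitzOnWith_of_contDiffOn_Icc
    zero_lt_one hC le_rfl
  have hLip : LipschitzOnWith (1 * L) (fun u => ((g u : ℝ) : ℂ)) (Icc 0 1) :=
    Complex.isometry_ofReal.lipschitz.comp_lipschitzOnWith hL
  have hint : ∫ t in (0:ℝ)..1, ((g t : ℝ) : ℂ) = 0 := by
    rw [intervalIntegral.integral_ofReal, hI]; simp
  obtain ⟨h1, h2⟩ :=
    Literature.NumberTheory.LFunctions.mellin_tsum_indicator_comp_mul_nat zero_lt_one hLip hint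
      hw hw1
  have hc : MellinConvergent (fun y => ((latticeProfile g y : ℝ) : ℂ)) w ↔ MellinConvergent
      (fun x => ∑' n : ℕ, (Ioc (0:ℝ) 1).indicator (fun u => ((g u : ℝ) : ℂ))
        (((n + 1 : ℕ) : ℝ) * x)) w :=
    integrableOn_congr_fun (fun y hy => by simp only [tsum_indicator_eq_latticeProfile g hy])
      measurableSet_Ioi
  have hm : mellin (fun y => ((latticeProfile g y : ℝ) : ℂ)) w = mellin
      (fun x => ∑' n : ℕ, (Ioc (0:ℝ) 1).indicator (fun u => ((g u : ℝ) : ℂ))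
        (((n + 1 : ℕ) : ℝ) * x)) w :=
    setIntegral_congr_fun measurableSet_Ioi fun y hy => by
      simp only [tsum_indicator_eq_latticeProfile g hy]
  exact ⟨hc.mpr h1, by rw [hm, h2, mellin_indicator_ofReal]⟩

/-! ## Integration by parts against `u^{w−1}` -/

/-- One-sided IBP for an admissible generator: `∫₀¹ g(u)u^{w−1} du = −(1/w)·∫₀¹ g′(u)u^w du`
for `Re w > 0` (`g(1) = 0` kills the boundary term at `1`, `Re w > 0` the one at `0`).
[folklore] -/
theorem integral_mul_cpow_eq_of_admissible {g : ℝ → ℝ} (hg : SmoothSectorAdmissible g) {w : ℂ}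
    (hw : 0 < w.re) :
    ∫ u in Ioo (0:ℝ) 1, ((g u : ℝ) : ℂ) * (u : ℂ) ^ (w - 1)
      = -(1 / w) * ∫ u in Ioo (0:ℝ) 1, ((deriv g u : ℝ) : ℂ) * (u : ℂ) ^ w := by
  obtain ⟨hC, h1, _, _⟩ := hg
  have hw0 : w ≠ 0 := fun h => by rw [h, Complex.zero_re] at hw; exact lt_irrefl _ hw
  -- the IBP data
  have hu : ContinuousOn (fun x : ℝ => (x : ℂ) ^ w) (uIcc 0 1) := fun x _ =>
    (Complex.continuousAt_ofReal_cpow_const x w (Or.inl hw)).continuousWithinAt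
  have hv : ContinuousOn (fun x : ℝ => ((g x : ℝ) : ℂ)) (uIcc 0 1) := by
    rw [uIcc_of_le zero_le_one]
    exact Complex.continuous_ofReal.comp_continuousOn hC.continuousOn
  have huu' : ∀ x ∈ Ioo (min 0 1 : ℝ) (max 0 1),
      HasDerivWithinAt (fun x : ℝ => (x : ℂ) ^ w) (w * (x : ℂ) ^ (w - 1)) (Ioi x) x := by
    intro x hx
    rw [min_eq_left zero_le_one, max_eq_right zero_le_one] at hx
    exact (hasDerivAt_ofReal_cpow_const hx.1.ne' hw0).hasDerivWithinAt
  have hvv' : ∀ x ∈ Ioo (min 0 1 : ℝ) (max 0 1),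
      HasDerivWithinAt (fun x : ℝ => ((g x : ℝ) : ℂ)) (((deriv g x : ℝ) : ℂ)) (Ioi x) x := by
    intro x hx
    rw [min_eq_left zero_le_one, max_eq_right zero_le_one] at hx
    exact (hasDerivAt_of_contDiffOn_Icc hC hx).ofReal_comp.hasDerivWithinAt
  have hu' : IntervalIntegrable (fun x : ℝ => w * (x : ℂ) ^ (w - 1)) volume 0 1 :=
    (intervalIntegral.intervalIntegrable_cpow' (by simp; linarith)).const_mul w
  have hv' : IntervalIntegrable (fun x : ℝ => ((deriv g x : ℝ) : ℂ)) volume 0 1 := by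
    have h := intervalIntegrable_deriv_of_contDiffOn hC
    rw [intervalIntegrable_iff_integrableOn_Ioo_of_le zero_le_one] at h ⊢
    exact h.ofReal
  have hibp := intervalIntegral.integral_mul_deriv_eq_deriv_mul_of_hasDeriv_right hu hv huu'
    hvv' hu' hv'
  -- evaluate the boundary terms
  rw [h1, Complex.ofReal_zero, mul_zero, Complex.zero_cpow hw0, zero_mul,
    sub_zero, zero_sub] at hibp
  -- convert interval integrals to set integrals over `Ioo 0 1`
  rw [intervalIntegral.integral_of_le zero_le_one, intervalIntegral.integral_of_le zero_le_one,
    integral_Ioc_eq_integral_Ioo, integral_Ioc_eq_integral_Ioo] at hibp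
  have eL : ∫ u in Ioo (0:ℝ) 1, ((deriv g u : ℝ) : ℂ) * (u : ℂ) ^ w
      = ∫ u in Ioo (0:ℝ) 1, (u : ℂ) ^ w * ((deriv g u : ℝ) : ℂ) :=
    setIntegral_congr_fun measurableSet_Ioo fun u _ => by ring
  have eR : ∫ u in Ioo (0:ℝ) 1, w * (u : ℂ) ^ (w - 1) * ((g u : ℝ) : ℂ)
      = w * ∫ u in Ioo (0:ℝ) 1, ((g u : ℝ) : ℂ) * (u : ℂ) ^ (w - 1) := by
    rw [← integral_const_mul]
    exact setIntegral_congr_fun measurableSet_Ioo fun u _ => by ring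
  rw [eL, hibp, eR]
  field_simp

/-! ## Plateau bookkeeping: `𝓜h = 𝓜Ψ + h₀/w` and `𝓜H = 𝓜Ψ + h₀/w` -/

/-- The plateau term on `(0,1)`: `𝓜(c·1_{(0,1)})(w)` converges absolutely and equals `c/w`
for `Re w > 0`. [folklore] -/
theorem hasMellin_indicator_Ioo_const (c : ℂ) {w : ℂ} (hw : 0 < w.re) :
    MellinConvergent ((Ioo (0:ℝ) 1).indicator fun _ => c) w ∧
      mellin ((Ioo (0:ℝ) 1).indicator fun _ => c) w = c / w := by
  have hw0 : w ≠ 0 := fun h => by rw [h, Complex.zero_re] at hw; exact lt_irrefl _ hw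
  have hpt : (fun y : ℝ => (y : ℂ) ^ (w - 1) • (Ioo (0:ℝ) 1).indicator (fun _ => c) y)
      = (Ioo (0:ℝ) 1).indicator (fun y => c * (y : ℂ) ^ (w - 1)) := by
    funext y
    by_cases hy : y ∈ Ioo (0:ℝ) 1
    · rw [indicator_of_mem hy, indicator_of_mem hy, smul_eq_mul, mul_comm]
    · rw [indicator_of_notMem hy, indicator_of_notMem hy, smul_zero]
  have hF : IntegrableOn (fun y : ℝ => c * (y : ℂ) ^ (w - 1)) (Ioo (0:ℝ) 1) := by
    have h := (intervalIntegral.intervalIntegrable_cpow' (a := 0) (b := 1) (r := w - 1)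
      (by simp; linarith))
    rw [intervalIntegrable_iff_integrableOn_Ioo_of_le zero_le_one] at h
    exact h.const_mul c
  refine ⟨?_, ?_⟩
  · unfold MellinConvergent
    rw [hpt]
    exact (hF.integrable_indicator measurableSet_Ioo).integrableOn
  · unfold mellin
    rw [hpt, setIntegral_indicator measurableSet_Ioo, inter_eq_right.mpr Ioo_subset_Ioi_self,
      integral_const_mul, ← integral_Ioc_eq_integral_Ioo,
      ← intervalIntegral.integral_of_le zero_le_one,
      integral_cpow (Or.inl (by simp; linarith)), sub_add_cancel, Complex.ofReal_one,
      Complex.one_cpow, Complex.ofReal_zero, Complex.zero_cpow hw0, sub_zero]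
    field_simp

/-- The plateau term on `[1,∞)`: `𝓜(c·1_{[1,∞)})(w)` converges absolutely and equals `−c/w`
for `Re w < 0`. [folklore] -/
theorem hasMellin_indicator_Ici_const (c : ℂ) {w : ℂ} (hw : w.re < 0) :
    MellinConvergent ((Ici (1:ℝ)).indicator fun _ => c) w ∧
      mellin ((Ici (1:ℝ)).indicator fun _ => c) w = -c / w := by
  have hw0 : w ≠ 0 := fun h => by rw [h, Complex.zero_re] at hw; exact lt_irrefl _ hw
  have hw' : (w - 1).re < -1 := by simp; linarith
  have hpt : (fun y : ℝ => (y : ℂ) ^ (w - 1) • (Ici (1:ℝ)).indicator (fun _ => c) y)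
      = (Ici (1:ℝ)).indicator (fun y => c * (y : ℂ) ^ (w - 1)) := by
    funext y
    by_cases hy : y ∈ Ici (1:ℝ)
    · rw [indicator_of_mem hy, indicator_of_mem hy, smul_eq_mul, mul_comm]
    · rw [indicator_of_notMem hy, indicator_of_notMem hy, smul_zero]
  have hF : IntegrableOn (fun y : ℝ => c * (y : ℂ) ^ (w - 1)) (Ici (1:ℝ)) := by
    rw [integrableOn_Ici_iff_integrableOn_Ioi]
    exact (integrableOn_Ioi_cpow_of_lt hw' zero_lt_one).const_mul c
  have hsub : Ici (1:ℝ) ⊆ Ioi 0 := fun y hy => lt_of_lt_of_le zero_lt_one (mem_Ici.mp hy)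
  refine ⟨?_, ?_⟩
  · unfold MellinConvergent
    rw [hpt]
    exact (hF.integrable_indicator measurableSet_Ici).integrableOn
  · unfold mellin
    rw [hpt, setIntegral_indicator measurableSet_Ici, inter_eq_right.mpr hsub,
      integral_const_mul, integral_Ici_eq_integral_Ioi, integral_Ioi_cpow_of_lt hw' zero_lt_one,
      sub_add_cancel, Complex.ofReal_one, Complex.one_cpow]
    field_simp

/-- **Plateau bookkeeping on `Re w > 0`**: `Ψ` has an absolutely convergent Mellin transform and
`𝓜h(w) = 𝓜Ψ(w) + h₀/w` (`w ≠ 1`, admissible `g`). [folklore] -/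
theorem mellin_latticeProfile_eq_profileDev_add {g : ℝ → ℝ} (hg : SmoothSectorAdmissible g)
    {w : ℂ} (hw : 0 < w.re) (hw1 : w ≠ 1) :
    MellinConvergent (profileDev g) w ∧
      mellin (fun y => ((latticeProfile g y : ℝ) : ℂ)) w
        = mellin (profileDev g) w + ((latticePlateau g : ℝ) : ℂ) / w := by
  obtain ⟨hh, _⟩ := mellin_latticeProfile_eq hg hw hw1
  obtain ⟨hi, hiv⟩ := hasMellin_indicator_Ioo_const ((latticePlateau g : ℝ) : ℂ) hw
  have hsub := hasMellin_sub hh hi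
  have hcongr : ∀ y ∈ Ioi (0:ℝ), ((latticeProfile g y : ℝ) : ℂ)
      - (Ioo (0:ℝ) 1).indicator (fun _ => ((latticePlateau g : ℝ) : ℂ)) y = profileDev g y := by
    intro y hy
    rw [latticeProfile_ofReal_eq_profileDev_add hg.2.1 hy]; ring
  have hc : MellinConvergent (profileDev g) w :=
    (integrableOn_congr_fun (fun y hy => by simp only [hcongr y hy]) measurableSet_Ioi).mp hsub.1
  have hm : mellin (profileDev g) w = mellin (fun y => ((latticeProfile g y : ℝ) : ℂ)) w
      - ((latticePlateau g : ℝ) : ℂ) / w := by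
    rw [← hiv, ← hsub.2]
    exact (setIntegral_congr_fun measurableSet_Ioi fun y hy => by simp only [hcongr y hy]).symm
  exact ⟨hc, by rw [hm]; ring⟩

/-- **Plateau bookkeeping on `Re w < 0`**: if the profile function `H` of item 21565 has an
absolutely convergent Mellin transform at `w`, then so does `Ψ`, and `𝓜H(w) = 𝓜Ψ(w) + h₀/w`.
[folklore] -/
theorem mellin_profileFun_eq_profileDev_add {g : ℝ → ℝ} {w : ℂ} (hw : w.re < 0)
    (hH : MellinConvergent (profileFun g) w) :
    MellinConvergent (profileDev g) w ∧
      mellin (profileFun g) w = mellin (profileDev g) w + ((latticePlateau g : ℝ) : ℂ) / w := by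
  obtain ⟨hi, hiv⟩ := hasMellin_indicator_Ici_const ((latticePlateau g : ℝ) : ℂ) hw
  have hadd := hasMellin_add hH hi
  have he : (fun y => profileFun g y
      + (Ici (1:ℝ)).indicator (fun _ => ((latticePlateau g : ℝ) : ℂ)) y) = profileDev g := by
    funext y
    rw [profileFun_eq_profileDev_sub]; ring
  rw [he] at hadd
  refine ⟨hadd.1, ?_⟩
  rw [hadd.2, hiv]; ring

end Summit.RiemannHypothesis.RiemannHypothesis.Theorems.SmoothSectorHardy

end
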